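import Literature.Probability.Percolation.HorizontalTransportHonest
import Literature.Probability.Percolation.VerticalTransportHonest
import Literature.Probability.Percolation.BoxCrossingRealBoxes
import HarnessLib

/-!
# Grimmett–Manolescu 2014, Corollary 6.2: isoradial square lattices have the box-crossing property

Grimmett–Manolescu, *Bond percolation on isoradial graphs* (PTRF 159 (2014) 273–327 =
arXiv:1204.0505), §6: "**Corollary 6.2.** For `ε > 0` there exists `δ = δ(ε) > 0` such that
every isoradial square lattice satisfying BAC(ε) has the box-crossing property BXP(δ)."

This file plugs the two transports of the star–triangle proof — Proposition 6.4
(`HorizontalTransportHonest.horizontal_transport`, transport of horizontal crossings through the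
regular block, §6.2) and Proposition 6.8 (`VerticalTransportHonest.vertical_transport`, transport
of vertical crossings, §6.3) — into the iteration of §6.1–§6.2 (`BoxCrossingCor62.cor62_explicit`:
base case = RSW for `ℤ²`, Prop. 6.1 three times with a transposition in between), and states the
result in index (diamond) coordinates: uniformly over all pairs of angle sequences with
`β_j - α_i ∈ [ε, π - ε]` (GM14 (4.5), all rhombi of `G_{α,β}` have angles `≥ ε`), the
`P_{α,β}`-probabilities of left–right crossings of the index boxes `[A, A + ρn] × [B, B + n]` and of
top–bottom crossings of `[A, A + n] × [B, B + ρn]` are bounded below by `c(ε, ρ) > 0` for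
`n ≥ n₀(ε, ρ)`. (The passage from index boxes to Euclidean rectangles of the isoradial embedding —
GM14 Prop. 4.2 — and the upper bounds `1 - c` by duality belong to the square-grid geometry of
§4 and §7.)

## References

* G. R. Grimmett, I. Manolescu, PTRF 159 (2014) 273–327, arXiv:1204.0505, §6 (Prop. 6.1,
  Cor. 6.2, Prop. 6.4, Prop. 6.8).
-/

noncomputable section

namespace Literature.Probability.Percolation

open LatticeModels StarTriangle Real MeasureTheory Complex

namespace TrackExchange

/-- **GM14 Corollary 6.2 in index coordinates (lower bounds).** For `0 < ε ≤ π/2` and `ρ ≥ 1`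
there are `c > 0` and `n₀` such that for all angle sequences `α, β : ℤ → ℝ` with
`β_j - α_i ∈ [ε, π - ε]` for all `i, j`, all `n ≥ n₀` and all `A, B ∈ ℤ`:
`P_{α,β}(C_h of [A, A+ρn] × [B, B+n]) ≥ c` and `P_{α,β}(C_v of [A, A+n] × [B, B+ρn]) ≥ c`, where
`P_{α,β} = prodBernoulli (gmWeight α β)` is the canonical measure of `G_{α,β}` and the boxes are the
index boxes drawn by `zDia`. [cite: GrimmettManolescu2014Isoradial, §6.2 Corollary 6.2] -/
theorem isoradialSquare_boxCrossing_lower {ε : ℝ} (hε : 0 < ε) (hε' : ε ≤ π / 2) {ρ : ℕ} (hρ : 1 ≤ ρ) :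
    ∃ c > (0 : ℝ), ∃ n₀ : ℕ, ∀ (α β : ℤ → ℝ), AnglesIn ε α β → ∀ n : ℕ, n₀ ≤ n → ∀ A B : ℤ,
      c ≤ (prodBernoulli (Percolation.gmWeight α β)).real
          (embRectCrossing (fun v => zDia v - ((A : ℂ) + (B : ℂ) * I)) (ρ * n : ℕ) n) ∧
      c ≤ (prodBernoulli (Percolation.gmWeight α β)).real
          (embTBCrossing (fun v => zDia v - ((A : ℂ) + (B : ℂ) * I)) n (ρ * n : ℕ)) := by
  have hθ := VData.θ_pos_le hε (by linarith)
  exact cor62_explicit hε' hθ.1 hθ.2 (horizontal_transport hε hε')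
    (fun N hN u hu α β ξ hξ hβ => vertical_transport hε hN hu α β ξ hξ hβ) hρ

/-- **GM14 Corollary 6.2, box-crossing form (lower bounds).** For `0 < ε ≤ π/2` and every real
`ρ > 0` there are `c > 0` and `n₀` such that for all `α, β` with `β_j - α_i ∈ [ε, π - ε]`, all
`n ≥ n₀` and all `w ∈ ℂ`, the canonical measure `P_{α,β}` gives probability `≥ c` to the
left–right crossing of the translate by `w` of the `ρn × n` rectangle and to the top–bottom
crossing of the translate of the `n × ρn` rectangle of the straight drawing `zDia` (the tree's
`embRectCrossing` / `embTBCrossing`; i.e. the lower half of `BoxCrossingBounds P_{α,β} zDia ρ c n₀`).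
[cite: GrimmettManolescu2014Isoradial, §6.2 Corollary 6.2 with §2.2 Def. 2.2] -/
theorem isoradialSquare_boxCrossing_lower_real {ε : ℝ} (hε : 0 < ε) (hε' : ε ≤ π / 2) {ρ : ℝ} (hρ : 0 < ρ) :
    ∃ c > (0 : ℝ), ∃ n₀ : ℕ, ∀ (α β : ℤ → ℝ), AnglesIn ε α β → ∀ n : ℕ, n₀ ≤ n → ∀ w : ℂ,
      c ≤ (prodBernoulli (Percolation.gmWeight α β)).real (embRectCrossing (fun v => zDia v - w) (ρ * n) n) ∧
      c ≤ (prodBernoulli (Percolation.gmWeight α β)).real (embTBCrossing (fun v => zDia v - w) n (ρ * n)) := by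
  have hθ := VData.θ_pos_le hε (by linarith)
  have hb := fun (ρ' : ℕ) (hρ' : 1 ≤ ρ') => cor62_bounds (θ := VData.θ ε) hε' hθ.1 hθ.2 (horizontal_transport hε hε')
    (fun N hN u hu α β ξ hξ hβ => vertical_transport hε hN hu α β ξ hξ hβ) hρ'
  obtain ⟨c, hc, n₀, h⟩ := realBoxes_of_bounds (C := anglesC ε) (fun ρ' hρ' => (hb ρ' hρ').1) (fun ρ' hρ' => (hb ρ' hρ').2) hρ
  exact ⟨c, hc, n₀, fun α β ha n hn w => h (α, β) ha n hn w⟩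

/-- **The same for the tree's embedding `gmEmbedding α β` and its hypotheses**: BAP(`ε'`) of
`G_{α,β}` (half-angle units, `RhombicEmbedding.HasBoundedAngles`) is `β_j - α_i ∈ [2ε', π - 2ε']`
(`hasBoundedAngles_gmEmbedding_iff`), and the canonical measure of `gmEmbedding α β` is
`P_{α,β}` (`isoradialPercolation_gmEmbedding`). [cite: GrimmettManolescu2014Isoradial, §6.2 Corollary 6.2 with §4.6 (4.5)] -/
theorem isoradialSquare_boxCrossing_lower_of_hasBoundedAngles {ε' : ℝ} (hε' : 0 < ε') {ρ : ℝ} (hρ : 0 < ρ) :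
    ∃ c > (0 : ℝ), ∃ n₀ : ℕ, ∀ (α β : ℤ → ℝ), (∀ i j, 0 < β j - α i ∧ β j - α i < π) →
      (gmEmbedding α β).HasBoundedAngles ε' → ∀ n : ℕ, n₀ ≤ n → ∀ w : ℂ,
      c ≤ (gmEmbedding α β).isoradialPercolation.real (embRectCrossing (fun v => zDia v - w) (ρ * n) n) ∧
      c ≤ (gmEmbedding α β).isoradialPercolation.real (embTBCrossing (fun v => zDia v - w) n (ρ * n)) := by
  by_cases h4 : 2 * ε' ≤ π / 2
  · obtain ⟨c, hc, n₀, h⟩ := isoradialSquare_boxCrossing_lower_real (ε := 2 * ε') (by linarith) h4 hρ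
    refine ⟨c, hc, n₀, fun α β hang hb n hn w => ?_⟩
    rw [isoradialPercolation_gmEmbedding hang]
    have ha : AnglesIn (2 * ε') α β := fun i j => by
      have := (hasBoundedAngles_gmEmbedding_iff hang hε').1 hb i j
      exact ⟨this.1, by linarith [this.2]⟩
    exact h α β ha n hn w
  · -- the class is empty
    refine ⟨1, one_pos, 0, fun α β hang hb n _ w => ?_⟩
    have := (hasBoundedAngles_gmEmbedding_iff hang hε').1 hb 0 0
    exfalso; linarith [this.1, this.2]

end TrackExchange

end Literature.Probability.Percolation
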